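import Summits.ABC.IUTFork.Conditional.FreyLegendreP6EngineIsogenyHeight
import HarnessLib

/-!
# the HEX family `λ_k = 1/2 + 2/7^k` (14 carriers of `FreyLegendreAdmN3HexA/B.lean`, `FreyLegendreAdmHex10Axis2399.lean`): INHABITED datum types at EVERY prime `l ≥ 7` off the honest (P2) exclusions — the WHOLE AXIS of each carrier, NO certificates

PROOF-ONLY file (D-0012; 0 definitions, 0 `Prop` facts, no instance, no notation) of the abc-iut cell (seat abc-iut-w6-d102, gen 10;
row family «C:P6-N3-BANDS-INH», offer (η) «C:P6-N3-TAIL-ISOGENY-HEIGHT»; line: route-ABC-IUTThetaPilot ▸ stmt-ABC-19678 ▸ RESHAPE-4 ▸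
`stub_cor312PerImage`, instrument row = non-vacuity of the (P)-reading binders). For EACH carrier `λ = a/c`
tabulated in `FreyLegendreAdmN3HexA/B.lean` / `FreyLegendreAdmHex*` (finitely many levels by Frobenius certificates) ONE theorem `<Tag>.nonempty_thetaVolumeDatumAt_axis (hl : l.Prime) (h7 : 7 ≤ l) (hex : l ∉ Ex)`:
the datum type `Cor22.ThetaVolumeDatumAt (ratPoint λ) l` is INHABITED at EVERY prime `l ≥ 7` outside the honest (P2) exclusion
list `Ex` (the primes `l ≥ 7` dividing an exponent `e_p = 2·v_p(abc)` at an odd `p`, or `e_2 − 8`; empty for many carriers) —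
by the ISOGENY–HEIGHT ENGINE v5 `FreyAdm.nonempty_thetaVolumeDatumAt_triple_axis` (`FreyLegendreP6EngineIsogenyHeight`): (P6) at
every prime `l ≥ 7` from the ONE inequality of naturals `2^516·c^48·7^48 < m^70` (`abc = 2^k·m`, `m` odd; explicit [GenEll] Lem. 3.5
+ Faltings + Silverman (9, 37) + Tate transvection, all tree theorems, `decide +kernel` once), (P2) structurally above the exponent
bound `B` and by two decidable checks below it, (P5)/`UP`/`AdmitsCore` from the factorisation, and the route's proved
`ThetaPartII.stub_thetaData`. NO level list, NO certificate, NO band file: every finite band of these axes landed so far (and every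
refuted `∀ T` band of the R-W table on these carriers) now quantifies over an INHABITED datum type at EVERY admissible prime, and so
does the infinite tail that finitely many certificates never served.
HONEST SCOPE: «inhabited» = non-vacuity of OUR typed datum type over OUR containers; classical arithmetic (Faltings 1983, Silverman
1986, the Tate curve) AS TYPED AND PROVED in the tree; Serre/Mazur NOT used; the excluded primes are exactly where (P2) fails AS TYPED
(nothing is claimed there); inhabited-as-typed ≠ true-in-print; nothing about [IUTchIII] Cor. 3.12 or `S_H`; Szpiro-badness NOT
claimed; no side taken on any author; typed ≠ proved; no abc claim.
[cite: Mochizuki2012, IUTchIV Cor. 2.2 (ii) proof (P2)(P5)(P6)(P7) pp. 45–46] [cite: MochizukiGenEll2010, Lem. 3.5 p. 17]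
[cite: Silverman1986, Prop. 2.1 (p. 257)] [claim: Mochizuki2012, status: disputed] for every IUT sentence quoted.
-/

noncomputable section

open scoped Classical

namespace Summit.ABC.IUTFork.Conditional

open Literature.NumberTheory.EllipticCurves Literature.NumberTheory.DiophantineGeometry.GenEll
open Literature.NumberTheory.DiophantineGeometry Literature.IUT.LogVolume Literature.IUT.LogVolume.Cor22
open Literature.NumberTheory.DiophantineGeometry.UniformABCConjecture

/-- **INHABITED datum types at `ratPoint ((2 : ℚ)⁻¹ + 2 / 7 ^ 10)` at EVERY prime `l ≥ 7`** (no exclusion; exponents of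
`(abc)²` on `[2, 3, 5, 7, 13, 113, 431, 3361, 2499781]` all `< 21`; `abc = 2^1·m`): engine v5 `FreyAdm.nonempty_thetaVolumeDatumAt_triple_axis` at `lo = 7` — the
carrier's WHOLE admissible axis. [cite: Mochizuki2012, IUTchIV Cor. 2.2 (ii) proof (P2)(P5)(P6)(P7) pp. 45–46] [claim: Mochizuki2012, status: disputed] -/
theorem FreyP6Hex10.nonempty_thetaVolumeDatumAt_axis {l : ℕ} (hl : l.Prime) (h7 : 7 ≤ l) (hex : l ∉ ([] : List ℕ)) :
    Nonempty (Cor22.ThetaVolumeDatumAt (ratPoint ((2 : ℚ)⁻¹ + 2 / 7 ^ 10)) l) := by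
  have hq : ((2 : ℚ)⁻¹ + 2 / 7 ^ 10) = (((7 ^ 10 + 4 : ℕ) : ℚ) / (2 * 7 ^ 10 : ℕ)) := by norm_num
  rw [hq]
  exact FreyAdm.nonempty_thetaVolumeDatumAt_triple_axis (a := 7 ^ 10 + 4) (b := 3 * 5 * 13 * 431 * 3361) (c := 2 * 7 ^ 10) (by unfold IsABCTriple; decide +kernel)
    (Il := [2, 3, 5, 7, 13, 113, 431, 3361, 2499781]) (e := fun p => if p = 2 then 2 else if p = 3 then 2 else if p = 5 then 2 else if p = 7 then 20 else if p = 13 then 2 else if p = 113 then 2 else if p = 431 then 2 else if p = 3361 then 2 else if p = 2499781 then 2 else 0)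
    (by intro p hp; fin_cases hp <;> norm_num) (by decide) (by decide +kernel) (by decide +kernel) (by unfold Cor22.coreExceptionalJ; decide +kernel)
    7 (by norm_num) 21 (by decide +kernel) [] (by decide) (by decide) 3 5 (by decide) (by decide) (by norm_num) (by norm_num) (by norm_num)
    1 ((7 ^ 10 + 4) * (3 * 5 * 13 * 431 * 3361) * (7 ^ 10)) (by norm_num) (by norm_num) (by decide +kernel) l hl h7 hex

/-- **INHABITED datum types at `ratPoint ((2 : ℚ)⁻¹ + 2 / 7 ^ 1)` at EVERY prime `l ≥ 12`** (no exclusion; exponents of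
`(abc)²` on `[2, 3, 7, 11]` all `< 8`; `abc = 2^1·m`): engine v5 `FreyAdm.nonempty_thetaVolumeDatumAt_triple_axis` at `lo = 12` — the
carrier's WHOLE admissible axis. [cite: Mochizuki2012, IUTchIV Cor. 2.2 (ii) proof (P2)(P5)(P6)(P7) pp. 45–46] [claim: Mochizuki2012, status: disputed] -/
theorem FreyP6Hex1.nonempty_thetaVolumeDatumAt_axis {l : ℕ} (hl : l.Prime) (h7 : 12 ≤ l) (hex : l ∉ ([] : List ℕ)) :
    Nonempty (Cor22.ThetaVolumeDatumAt (ratPoint ((2 : ℚ)⁻¹ + 2 / 7 ^ 1)) l) := by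
  have hq : ((2 : ℚ)⁻¹ + 2 / 7 ^ 1) = (((7 ^ 1 + 4 : ℕ) : ℚ) / (2 * 7 ^ 1 : ℕ)) := by norm_num
  rw [hq]
  exact FreyAdm.nonempty_thetaVolumeDatumAt_triple_axis (a := 7 ^ 1 + 4) (b := 3) (c := 2 * 7 ^ 1) (by unfold IsABCTriple; decide +kernel)
    (Il := [2, 3, 7, 11]) (e := fun p => if p = 2 then 2 else if p = 3 then 2 else if p = 7 then 2 else if p = 11 then 2 else 0)
    (by intro p hp; fin_cases hp <;> norm_num) (by decide) (by decide +kernel) (by decide +kernel) (by unfold Cor22.coreExceptionalJ; decide +kernel)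
    12 (by norm_num) 8 (by decide +kernel) [] (by decide) (by decide) 3 7 (by decide) (by decide) (by norm_num) (by norm_num) (by norm_num)
    1 ((7 ^ 1 + 4) * (3) * (7 ^ 1)) (by norm_num) (by norm_num) (by decide +kernel) l hl h7 hex

/-- **INHABITED datum types at `ratPoint ((2 : ℚ)⁻¹ + 2 / 7 ^ 2)` at EVERY prime `l ≥ 7`** (no exclusion; exponents of
`(abc)²` on `[2, 3, 5, 7, 53]` all `< 8`; `abc = 2^1·m`): engine v5 `FreyAdm.nonempty_thetaVolumeDatumAt_triple_axis` at `lo = 7` — the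
carrier's WHOLE admissible axis. [cite: Mochizuki2012, IUTchIV Cor. 2.2 (ii) proof (P2)(P5)(P6)(P7) pp. 45–46] [claim: Mochizuki2012, status: disputed] -/
theorem FreyP6Hex2.nonempty_thetaVolumeDatumAt_axis {l : ℕ} (hl : l.Prime) (h7 : 7 ≤ l) (hex : l ∉ ([] : List ℕ)) :
    Nonempty (Cor22.ThetaVolumeDatumAt (ratPoint ((2 : ℚ)⁻¹ + 2 / 7 ^ 2)) l) := by
  have hq : ((2 : ℚ)⁻¹ + 2 / 7 ^ 2) = (((7 ^ 2 + 4 : ℕ) : ℚ) / (2 * 7 ^ 2 : ℕ)) := by norm_num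
  rw [hq]
  exact FreyAdm.nonempty_thetaVolumeDatumAt_triple_axis (a := 7 ^ 2 + 4) (b := 3 ^ 2 * 5) (c := 2 * 7 ^ 2) (by unfold IsABCTriple; decide +kernel)
    (Il := [2, 3, 5, 7, 53]) (e := fun p => if p = 2 then 2 else if p = 3 then 4 else if p = 5 then 2 else if p = 7 then 4 else if p = 53 then 2 else 0)
    (by intro p hp; fin_cases hp <;> norm_num) (by decide) (by decide +kernel) (by decide +kernel) (by unfold Cor22.coreExceptionalJ; decide +kernel)
    7 (by norm_num) 8 (by decide +kernel) [] (by decide) (by decide) 3 5 (by decide) (by decide) (by norm_num) (by norm_num) (by norm_num)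
    1 ((7 ^ 2 + 4) * (3 ^ 2 * 5) * (7 ^ 2)) (by norm_num) (by norm_num) (by decide +kernel) l hl h7 hex

/-- **INHABITED datum types at `ratPoint ((2 : ℚ)⁻¹ + 2 / 7 ^ 3)` at EVERY prime `l ≥ 7`** (no exclusion; exponents of
`(abc)²` on `[2, 3, 7, 113, 347]` all `< 8`; `abc = 2^1·m`): engine v5 `FreyAdm.nonempty_thetaVolumeDatumAt_triple_axis` at `lo = 7` — the
carrier's WHOLE admissible axis. [cite: Mochizuki2012, IUTchIV Cor. 2.2 (ii) proof (P2)(P5)(P6)(P7) pp. 45–46] [claim: Mochizuki2012, status: disputed] -/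
theorem FreyP6Hex3.nonempty_thetaVolumeDatumAt_axis {l : ℕ} (hl : l.Prime) (h7 : 7 ≤ l) (hex : l ∉ ([] : List ℕ)) :
    Nonempty (Cor22.ThetaVolumeDatumAt (ratPoint ((2 : ℚ)⁻¹ + 2 / 7 ^ 3)) l) := by
  have hq : ((2 : ℚ)⁻¹ + 2 / 7 ^ 3) = (((7 ^ 3 + 4 : ℕ) : ℚ) / (2 * 7 ^ 3 : ℕ)) := by norm_num
  rw [hq]
  exact FreyAdm.nonempty_thetaVolumeDatumAt_triple_axis (a := 7 ^ 3 + 4) (b := 3 * 113) (c := 2 * 7 ^ 3) (by unfold IsABCTriple; decide +kernel)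
    (Il := [2, 3, 7, 113, 347]) (e := fun p => if p = 2 then 2 else if p = 3 then 2 else if p = 7 then 6 else if p = 113 then 2 else if p = 347 then 2 else 0)
    (by intro p hp; fin_cases hp <;> norm_num) (by decide) (by decide +kernel) (by decide +kernel) (by unfold Cor22.coreExceptionalJ; decide +kernel)
    7 (by norm_num) 8 (by decide +kernel) [] (by decide) (by decide) 3 7 (by decide) (by decide) (by norm_num) (by norm_num) (by norm_num)
    1 ((7 ^ 3 + 4) * (3 * 113) * (7 ^ 3)) (by norm_num) (by norm_num) (by decide +kernel) l hl h7 hex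

/-- **INHABITED datum types at `ratPoint ((2 : ℚ)⁻¹ + 2 / 7 ^ 4)` at EVERY prime `l ≥ 7`** (no exclusion; exponents of
`(abc)²` on `[2, 3, 5, 7, 13, 17, 37, 47]` all `< 9`; `abc = 2^1·m`): engine v5 `FreyAdm.nonempty_thetaVolumeDatumAt_triple_axis` at `lo = 7` — the
carrier's WHOLE admissible axis. [cite: Mochizuki2012, IUTchIV Cor. 2.2 (ii) proof (P2)(P5)(P6)(P7) pp. 45–46] [claim: Mochizuki2012, status: disputed] -/
theorem FreyP6Hex4.nonempty_thetaVolumeDatumAt_axis {l : ℕ} (hl : l.Prime) (h7 : 7 ≤ l) (hex : l ∉ ([] : List ℕ)) :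
    Nonempty (Cor22.ThetaVolumeDatumAt (ratPoint ((2 : ℚ)⁻¹ + 2 / 7 ^ 4)) l) := by
  have hq : ((2 : ℚ)⁻¹ + 2 / 7 ^ 4) = (((7 ^ 4 + 4 : ℕ) : ℚ) / (2 * 7 ^ 4 : ℕ)) := by norm_num
  rw [hq]
  exact FreyAdm.nonempty_thetaVolumeDatumAt_triple_axis (a := 7 ^ 4 + 4) (b := 3 * 17 * 47) (c := 2 * 7 ^ 4) (by unfold IsABCTriple; decide +kernel)
    (Il := [2, 3, 5, 7, 13, 17, 37, 47]) (e := fun p => if p = 2 then 2 else if p = 3 then 2 else if p = 5 then 2 else if p = 7 then 8 else if p = 13 then 2 else if p = 17 then 2 else if p = 37 then 2 else if p = 47 then 2 else 0)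
    (by intro p hp; fin_cases hp <;> norm_num) (by decide) (by decide +kernel) (by decide +kernel) (by unfold Cor22.coreExceptionalJ; decide +kernel)
    7 (by norm_num) 9 (by decide +kernel) [] (by decide) (by decide) 3 5 (by decide) (by decide) (by norm_num) (by norm_num) (by norm_num)
    1 ((7 ^ 4 + 4) * (3 * 17 * 47) * (7 ^ 4)) (by norm_num) (by norm_num) (by decide +kernel) l hl h7 hex

/-- **INHABITED datum types at `ratPoint ((2 : ℚ)⁻¹ + 2 / 7 ^ 5)` at EVERY prime `l ≥ 7`** (no exclusion; exponents of
`(abc)²` on `[2, 3, 7, 1867, 16811]` all `< 11`; `abc = 2^1·m`): engine v5 `FreyAdm.nonempty_thetaVolumeDatumAt_triple_axis` at `lo = 7` — the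
carrier's WHOLE admissible axis. [cite: Mochizuki2012, IUTchIV Cor. 2.2 (ii) proof (P2)(P5)(P6)(P7) pp. 45–46] [claim: Mochizuki2012, status: disputed] -/
theorem FreyP6Hex5.nonempty_thetaVolumeDatumAt_axis {l : ℕ} (hl : l.Prime) (h7 : 7 ≤ l) (hex : l ∉ ([] : List ℕ)) :
    Nonempty (Cor22.ThetaVolumeDatumAt (ratPoint ((2 : ℚ)⁻¹ + 2 / 7 ^ 5)) l) := by
  have hq : ((2 : ℚ)⁻¹ + 2 / 7 ^ 5) = (((7 ^ 5 + 4 : ℕ) : ℚ) / (2 * 7 ^ 5 : ℕ)) := by norm_num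
  rw [hq]
  exact FreyAdm.nonempty_thetaVolumeDatumAt_triple_axis (a := 7 ^ 5 + 4) (b := 3 ^ 2 * 1867) (c := 2 * 7 ^ 5) (by unfold IsABCTriple; decide +kernel)
    (Il := [2, 3, 7, 1867, 16811]) (e := fun p => if p = 2 then 2 else if p = 3 then 4 else if p = 7 then 10 else if p = 1867 then 2 else if p = 16811 then 2 else 0)
    (by intro p hp; fin_cases hp <;> norm_num) (by decide) (by decide +kernel) (by decide +kernel) (by unfold Cor22.coreExceptionalJ; decide +kernel)
    7 (by norm_num) 11 (by decide +kernel) [] (by decide) (by decide) 3 7 (by decide) (by decide) (by norm_num) (by norm_num) (by norm_num)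
    1 ((7 ^ 5 + 4) * (3 ^ 2 * 1867) * (7 ^ 5)) (by norm_num) (by norm_num) (by decide +kernel) l hl h7 hex

/-- **INHABITED datum types at `ratPoint ((2 : ℚ)⁻¹ + 2 / 7 ^ 6)` at EVERY prime `l ≥ 7`** (no exclusion; exponents of
`(abc)²` on `[2, 3, 5, 7, 11, 23, 29, 31, 4057]` all `< 13`; `abc = 2^1·m`): engine v5 `FreyAdm.nonempty_thetaVolumeDatumAt_triple_axis` at `lo = 7` — the
carrier's WHOLE admissible axis. [cite: Mochizuki2012, IUTchIV Cor. 2.2 (ii) proof (P2)(P5)(P6)(P7) pp. 45–46] [claim: Mochizuki2012, status: disputed] -/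
theorem FreyP6Hex6.nonempty_thetaVolumeDatumAt_axis {l : ℕ} (hl : l.Prime) (h7 : 7 ≤ l) (hex : l ∉ ([] : List ℕ)) :
    Nonempty (Cor22.ThetaVolumeDatumAt (ratPoint ((2 : ℚ)⁻¹ + 2 / 7 ^ 6)) l) := by
  have hq : ((2 : ℚ)⁻¹ + 2 / 7 ^ 6) = (((7 ^ 6 + 4 : ℕ) : ℚ) / (2 * 7 ^ 6 : ℕ)) := by norm_num
  rw [hq]
  exact FreyAdm.nonempty_thetaVolumeDatumAt_triple_axis (a := 7 ^ 6 + 4) (b := 3 * 5 * 11 * 23 * 31) (c := 2 * 7 ^ 6) (by unfold IsABCTriple; decide +kernel)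
    (Il := [2, 3, 5, 7, 11, 23, 29, 31, 4057]) (e := fun p => if p = 2 then 2 else if p = 3 then 2 else if p = 5 then 2 else if p = 7 then 12 else if p = 11 then 2 else if p = 23 then 2 else if p = 29 then 2 else if p = 31 then 2 else if p = 4057 then 2 else 0)
    (by intro p hp; fin_cases hp <;> norm_num) (by decide) (by decide +kernel) (by decide +kernel) (by unfold Cor22.coreExceptionalJ; decide +kernel)
    7 (by norm_num) 13 (by decide +kernel) [] (by decide) (by decide) 3 5 (by decide) (by decide) (by norm_num) (by norm_num) (by norm_num)
    1 ((7 ^ 6 + 4) * (3 * 5 * 11 * 23 * 31) * (7 ^ 6)) (by norm_num) (by norm_num) (by decide +kernel) l hl h7 hex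

/-- **INHABITED datum types at `ratPoint ((2 : ℚ)⁻¹ + 2 / 7 ^ 7)` at EVERY prime `l ≥ 7`, `l ∉ [7]`** (honest (P2) exclusions `l = 7`; exponents of
`(abc)²` on `[2, 3, 7, 223, 1231, 823547]` all `< 15`; `abc = 2^1·m`): engine v5 `FreyAdm.nonempty_thetaVolumeDatumAt_triple_axis` at `lo = 7` — the
carrier's WHOLE admissible axis. [cite: Mochizuki2012, IUTchIV Cor. 2.2 (ii) proof (P2)(P5)(P6)(P7) pp. 45–46] [claim: Mochizuki2012, status: disputed] -/
theorem FreyP6Hex7.nonempty_thetaVolumeDatumAt_axis {l : ℕ} (hl : l.Prime) (h7 : 7 ≤ l) (hex : l ∉ ([7] : List ℕ)) :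
    Nonempty (Cor22.ThetaVolumeDatumAt (ratPoint ((2 : ℚ)⁻¹ + 2 / 7 ^ 7)) l) := by
  have hq : ((2 : ℚ)⁻¹ + 2 / 7 ^ 7) = (((7 ^ 7 + 4 : ℕ) : ℚ) / (2 * 7 ^ 7 : ℕ)) := by norm_num
  rw [hq]
  exact FreyAdm.nonempty_thetaVolumeDatumAt_triple_axis (a := 7 ^ 7 + 4) (b := 3 * 223 * 1231) (c := 2 * 7 ^ 7) (by unfold IsABCTriple; decide +kernel)
    (Il := [2, 3, 7, 223, 1231, 823547]) (e := fun p => if p = 2 then 2 else if p = 3 then 2 else if p = 7 then 14 else if p = 223 then 2 else if p = 1231 then 2 else if p = 823547 then 2 else 0)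
    (by intro p hp; fin_cases hp <;> norm_num) (by decide) (by decide +kernel) (by decide +kernel) (by unfold Cor22.coreExceptionalJ; decide +kernel)
    7 (by norm_num) 15 (by decide +kernel) [7] (by decide) (by decide) 3 7 (by decide) (by decide) (by norm_num) (by norm_num) (by norm_num)
    1 ((7 ^ 7 + 4) * (3 * 223 * 1231) * (7 ^ 7)) (by norm_num) (by norm_num) (by decide +kernel) l hl h7 hex

/-- **INHABITED datum types at `ratPoint ((2 : ℚ)⁻¹ + 2 / 7 ^ 8)` at EVERY prime `l ≥ 7`** (no exclusion; exponents of
`(abc)²` on `[2, 3, 5, 7, 41, 61, 89, 461, 2399]` all `< 17`; `abc = 2^1·m`): engine v5 `FreyAdm.nonempty_thetaVolumeDatumAt_triple_axis` at `lo = 7` — the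
carrier's WHOLE admissible axis. [cite: Mochizuki2012, IUTchIV Cor. 2.2 (ii) proof (P2)(P5)(P6)(P7) pp. 45–46] [claim: Mochizuki2012, status: disputed] -/
theorem FreyP6Hex8.nonempty_thetaVolumeDatumAt_axis {l : ℕ} (hl : l.Prime) (h7 : 7 ≤ l) (hex : l ∉ ([] : List ℕ)) :
    Nonempty (Cor22.ThetaVolumeDatumAt (ratPoint ((2 : ℚ)⁻¹ + 2 / 7 ^ 8)) l) := by
  have hq : ((2 : ℚ)⁻¹ + 2 / 7 ^ 8) = (((7 ^ 8 + 4 : ℕ) : ℚ) / (2 * 7 ^ 8 : ℕ)) := by norm_num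
  rw [hq]
  exact FreyAdm.nonempty_thetaVolumeDatumAt_triple_axis (a := 7 ^ 8 + 4) (b := 3 ^ 3 * 89 * 2399) (c := 2 * 7 ^ 8) (by unfold IsABCTriple; decide +kernel)
    (Il := [2, 3, 5, 7, 41, 61, 89, 461, 2399]) (e := fun p => if p = 2 then 2 else if p = 3 then 6 else if p = 5 then 2 else if p = 7 then 16 else if p = 41 then 2 else if p = 61 then 2 else if p = 89 then 2 else if p = 461 then 2 else if p = 2399 then 2 else 0)
    (by intro p hp; fin_cases hp <;> norm_num) (by decide) (by decide +kernel) (by decide +kernel) (by unfold Cor22.coreExceptionalJ; decide +kernel)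
    7 (by norm_num) 17 (by decide +kernel) [] (by decide) (by decide) 3 5 (by decide) (by decide) (by norm_num) (by norm_num) (by norm_num)
    1 ((7 ^ 8 + 4) * (3 ^ 3 * 89 * 2399) * (7 ^ 8)) (by norm_num) (by norm_num) (by decide +kernel) l hl h7 hex

/-- **INHABITED datum types at `ratPoint ((2 : ℚ)⁻¹ + 2 / 7 ^ 9)` at EVERY prime `l ≥ 7`** (no exclusion; exponents of
`(abc)²` on `[2, 3, 7, 13451201, 40353611]` all `< 19`; `abc = 2^1·m`): engine v5 `FreyAdm.nonempty_thetaVolumeDatumAt_triple_axis` at `lo = 7` — the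
carrier's WHOLE admissible axis. [cite: Mochizuki2012, IUTchIV Cor. 2.2 (ii) proof (P2)(P5)(P6)(P7) pp. 45–46] [claim: Mochizuki2012, status: disputed] -/
theorem FreyP6Hex9.nonempty_thetaVolumeDatumAt_axis {l : ℕ} (hl : l.Prime) (h7 : 7 ≤ l) (hex : l ∉ ([] : List ℕ)) :
    Nonempty (Cor22.ThetaVolumeDatumAt (ratPoint ((2 : ℚ)⁻¹ + 2 / 7 ^ 9)) l) := by
  have hq : ((2 : ℚ)⁻¹ + 2 / 7 ^ 9) = (((7 ^ 9 + 4 : ℕ) : ℚ) / (2 * 7 ^ 9 : ℕ)) := by norm_num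
  rw [hq]
  exact FreyAdm.nonempty_thetaVolumeDatumAt_triple_axis (a := 7 ^ 9 + 4) (b := 3 * 13451201) (c := 2 * 7 ^ 9) (by unfold IsABCTriple; decide +kernel)
    (Il := [2, 3, 7, 13451201, 40353611]) (e := fun p => if p = 2 then 2 else if p = 3 then 2 else if p = 7 then 18 else if p = 13451201 then 2 else if p = 40353611 then 2 else 0)
    (by intro p hp; fin_cases hp <;> norm_num) (by decide) (by decide +kernel) (by decide +kernel) (by unfold Cor22.coreExceptionalJ; decide +kernel)
    7 (by norm_num) 19 (by decide +kernel) [] (by decide) (by decide) 3 7 (by decide) (by decide) (by norm_num) (by norm_num) (by norm_num)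
    1 ((7 ^ 9 + 4) * (3 * 13451201) * (7 ^ 9)) (by norm_num) (by norm_num) (by decide +kernel) l hl h7 hex

/-- **INHABITED datum types at `ratPoint ((2 : ℚ)⁻¹ + 2 / 7 ^ 11)` at EVERY prime `l ≥ 7`, `l ∉ [11]`** (honest (P2) exclusions `l = 11`; exponents of
`(abc)²` on `[2, 3, 7, 11, 383, 12163, 14779, 573637]` all `< 23`; `abc = 2^1·m`): engine v5 `FreyAdm.nonempty_thetaVolumeDatumAt_triple_axis` at `lo = 7` — the
carrier's WHOLE admissible axis. [cite: Mochizuki2012, IUTchIV Cor. 2.2 (ii) proof (P2)(P5)(P6)(P7) pp. 45–46] [claim: Mochizuki2012, status: disputed] -/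
theorem FreyP6Hex11.nonempty_thetaVolumeDatumAt_axis {l : ℕ} (hl : l.Prime) (h7 : 7 ≤ l) (hex : l ∉ ([11] : List ℕ)) :
    Nonempty (Cor22.ThetaVolumeDatumAt (ratPoint ((2 : ℚ)⁻¹ + 2 / 7 ^ 11)) l) := by
  have hq : ((2 : ℚ)⁻¹ + 2 / 7 ^ 11) = (((7 ^ 11 + 4 : ℕ) : ℚ) / (2 * 7 ^ 11 : ℕ)) := by norm_num
  rw [hq]
  exact FreyAdm.nonempty_thetaVolumeDatumAt_triple_axis (a := 7 ^ 11 + 4) (b := 3 ^ 2 * 383 * 573637) (c := 2 * 7 ^ 11) (by unfold IsABCTriple; decide +kernel)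
    (Il := [2, 3, 7, 11, 383, 12163, 14779, 573637]) (e := fun p => if p = 2 then 2 else if p = 3 then 4 else if p = 7 then 22 else if p = 11 then 2 else if p = 383 then 2 else if p = 12163 then 2 else if p = 14779 then 2 else if p = 573637 then 2 else 0)
    (by intro p hp; fin_cases hp <;> norm_num) (by decide) (by decide +kernel) (by decide +kernel) (by unfold Cor22.coreExceptionalJ; decide +kernel)
    7 (by norm_num) 23 (by decide +kernel) [11] (by decide) (by decide) 3 7 (by decide) (by decide) (by norm_num) (by norm_num) (by norm_num)
    1 ((7 ^ 11 + 4) * (3 ^ 2 * 383 * 573637) * (7 ^ 11)) (by norm_num) (by norm_num) (by decide +kernel) l hl h7 hex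

/-- **INHABITED datum types at `ratPoint ((2 : ℚ)⁻¹ + 2 / 7 ^ 12)` at EVERY prime `l ≥ 7`** (no exclusion; exponents of
`(abc)²` on `[2, 3, 5, 7, 17, 71, 149, 157, 1657, 6961, 39217]` all `< 25`; `abc = 2^1·m`): engine v5 `FreyAdm.nonempty_thetaVolumeDatumAt_triple_axis` at `lo = 7` — the
carrier's WHOLE admissible axis. [cite: Mochizuki2012, IUTchIV Cor. 2.2 (ii) proof (P2)(P5)(P6)(P7) pp. 45–46] [claim: Mochizuki2012, status: disputed] -/
theorem FreyP6Hex12.nonempty_thetaVolumeDatumAt_axis {l : ℕ} (hl : l.Prime) (h7 : 7 ≤ l) (hex : l ∉ ([] : List ℕ)) :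
    Nonempty (Cor22.ThetaVolumeDatumAt (ratPoint ((2 : ℚ)⁻¹ + 2 / 7 ^ 12)) l) := by
  have hq : ((2 : ℚ)⁻¹ + 2 / 7 ^ 12) = (((7 ^ 12 + 4 : ℕ) : ℚ) / (2 * 7 ^ 12 : ℕ)) := by norm_num
  rw [hq]
  exact FreyAdm.nonempty_thetaVolumeDatumAt_triple_axis (a := 7 ^ 12 + 4) (b := 3 * 71 * 1657 * 39217) (c := 2 * 7 ^ 12) (by unfold IsABCTriple; decide +kernel)
    (Il := [2, 3, 5, 7, 17, 71, 149, 157, 1657, 6961, 39217]) (e := fun p => if p = 2 then 2 else if p = 3 then 2 else if p = 5 then 2 else if p = 7 then 24 else if p = 17 then 2 else if p = 71 then 2 else if p = 149 then 2 else if p = 157 then 2 else if p = 1657 then 2 else if p = 6961 then 2 else if p = 39217 then 2 else 0)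
    (by intro p hp; fin_cases hp <;> norm_num) (by decide) (by decide +kernel) (by decide +kernel) (by unfold Cor22.coreExceptionalJ; decide +kernel)
    7 (by norm_num) 25 (by decide +kernel) [] (by decide) (by decide) 3 5 (by decide) (by decide) (by norm_num) (by norm_num) (by norm_num)
    1 ((7 ^ 12 + 4) * (3 * 71 * 1657 * 39217) * (7 ^ 12)) (by norm_num) (by norm_num) (by decide +kernel) l hl h7 hex

/-- **INHABITED datum types at `ratPoint ((2 : ℚ)⁻¹ + 2 / 7 ^ 13)` at EVERY prime `l ≥ 7`, `l ∉ [13]`** (honest (P2) exclusions `l = 13`; exponents of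
`(abc)²` on `[2, 3, 7, 29, 37, 59, 67, 239, 5639, 547395539]` all `< 27`; `abc = 2^1·m`): engine v5 `FreyAdm.nonempty_thetaVolumeDatumAt_triple_axis` at `lo = 7` — the
carrier's WHOLE admissible axis. [cite: Mochizuki2012, IUTchIV Cor. 2.2 (ii) proof (P2)(P5)(P6)(P7) pp. 45–46] [claim: Mochizuki2012, status: disputed] -/
theorem FreyP6Hex13.nonempty_thetaVolumeDatumAt_axis {l : ℕ} (hl : l.Prime) (h7 : 7 ≤ l) (hex : l ∉ ([13] : List ℕ)) :
    Nonempty (Cor22.ThetaVolumeDatumAt (ratPoint ((2 : ℚ)⁻¹ + 2 / 7 ^ 13)) l) := by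
  have hq : ((2 : ℚ)⁻¹ + 2 / 7 ^ 13) = (((7 ^ 13 + 4 : ℕ) : ℚ) / (2 * 7 ^ 13 : ℕ)) := by norm_num
  rw [hq]
  exact FreyAdm.nonempty_thetaVolumeDatumAt_triple_axis (a := 7 ^ 13 + 4) (b := 3 * 59 * 547395539) (c := 2 * 7 ^ 13) (by unfold IsABCTriple; decide +kernel)
    (Il := [2, 3, 7, 29, 37, 59, 67, 239, 5639, 547395539]) (e := fun p => if p = 2 then 2 else if p = 3 then 2 else if p = 7 then 26 else if p = 29 then 2 else if p = 37 then 2 else if p = 59 then 2 else if p = 67 then 2 else if p = 239 then 2 else if p = 5639 then 2 else if p = 547395539 then 2 else 0)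
    (by intro p hp; fin_cases hp <;> norm_num) (by decide) (by decide +kernel) (by decide +kernel) (by unfold Cor22.coreExceptionalJ; decide +kernel)
    7 (by norm_num) 27 (by decide +kernel) [13] (by decide) (by decide) 3 7 (by decide) (by decide) (by norm_num) (by norm_num) (by norm_num)
    1 ((7 ^ 13 + 4) * (3 * 59 * 547395539) * (7 ^ 13)) (by norm_num) (by norm_num) (by decide +kernel) l hl h7 hex

/-- **INHABITED datum types at `ratPoint ((2 : ℚ)⁻¹ + 2 / 7 ^ 16)` at EVERY prime `l ≥ 7`** (no exclusion; exponents of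
`(abc)²` on `[2, 3, 5, 7, 11, 13, 15881, 443077, 1153921, 5764799]` all `< 33`; `abc = 2^1·m`): engine v5 `FreyAdm.nonempty_thetaVolumeDatumAt_triple_axis` at `lo = 7` — the
carrier's WHOLE admissible axis. [cite: Mochizuki2012, IUTchIV Cor. 2.2 (ii) proof (P2)(P5)(P6)(P7) pp. 45–46] [claim: Mochizuki2012, status: disputed] -/
theorem FreyP6Hex16.nonempty_thetaVolumeDatumAt_axis {l : ℕ} (hl : l.Prime) (h7 : 7 ≤ l) (hex : l ∉ ([] : List ℕ)) :
    Nonempty (Cor22.ThetaVolumeDatumAt (ratPoint ((2 : ℚ)⁻¹ + 2 / 7 ^ 16)) l) := by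
  have hq : ((2 : ℚ)⁻¹ + 2 / 7 ^ 16) = (((7 ^ 16 + 4 : ℕ) : ℚ) / (2 * 7 ^ 16 : ℕ)) := by norm_num
  rw [hq]
  exact FreyAdm.nonempty_thetaVolumeDatumAt_triple_axis (a := 7 ^ 16 + 4) (b := 3 * 11 ^ 2 * 15881 * 5764799) (c := 2 * 7 ^ 16) (by unfold IsABCTriple; decide +kernel)
    (Il := [2, 3, 5, 7, 11, 13, 15881, 443077, 1153921, 5764799]) (e := fun p => if p = 2 then 2 else if p = 3 then 2 else if p = 5 then 2 else if p = 7 then 32 else if p = 11 then 4 else if p = 13 then 2 else if p = 15881 then 2 else if p = 443077 then 2 else if p = 1153921 then 2 else if p = 5764799 then 2 else 0)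
    (by intro p hp; fin_cases hp <;> norm_num) (by decide) (by decide +kernel) (by decide +kernel) (by unfold Cor22.coreExceptionalJ; decide +kernel)
    7 (by norm_num) 33 (by decide +kernel) [] (by decide) (by decide) 3 5 (by decide) (by decide) (by norm_num) (by norm_num) (by norm_num)
    1 ((7 ^ 16 + 4) * (3 * 11 ^ 2 * 15881 * 5764799) * (7 ^ 16)) (by norm_num) (by norm_num) (by decide +kernel) l hl h7 hex

end Summit.ABC.IUTFork.Conditional

end
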